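import Mathlib
import HarnessLib
import Literature.Probability.MarkovChains.PeskunOrdering

/-!
# Spectral gaps of augmented kernels: refreshing an auxiliary variable on acceptance
# (Andrieu–Vihola 2016, Appendix, Lemma 45)

Topic `Literature/Probability/MarkovChains`; namespace `Literature.Probability.MarkovChains`.
PUBLISHED RESULT with our proof (finite form).  No named fact is introduced (D-0026); the three
definitions (`augKernel`, `augWeight`, `condMean`) have bodies.  Lemma / theorem numbers are those
of the arXiv version (1404.6909) held in the corpus.

THE RESULT [cite: AndrieuVihola2016, Appendix "Spectral gaps of augmented kernels", Lemma 45].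
"Assume `Π` is a Markov kernel on a measurable space `(E, 𝓕)` and reversible with respect to a
probability measure `μ`.  Suppose `Π` has the form `Π(x, dy) = p(x, dy) + δ_x(dy) r(x)`, where
`p(x, dy) ≥ 0` is a sub-probability kernel and `r(x) ∈ [0, 1]` for all `x ∈ E`.  Assume `ν(x, A)` is
a probability kernel from `(E, 𝓕)` to another measurable space `(S, 𝓢)`, and define the Markov
kernel `Π_ν(x, w; dy × du) := p(x, dy) ν(y, du) + δ_{x,w}(dy × du) r(x)`.  Then, denoting
`r^* := μ-ess sup_x r(x)` …
(a) `Π_ν` is reversible with respect to `μ_ν(dx × dw) = μ(dx) ν(x, dw)`,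
(b) `𝓔_Π(f) = 𝓔_{Π_ν}(f)` for all `f ∈ L²(E, μ)`, with `f(x, w) = f(x)`,
(c) `min{Gap_R(Π), 1 − r^*} ≤ Gap_R(Π_ν) ≤ Gap_R(Π)`,
(d) `min{Gap_L(Π), 1 + r_*} ≤ Gap_L(Π_ν) ≤ Gap_L(Π)`."
In words: a chain that, whenever it MOVES, also redraws an auxiliary variable `w ~ ν(y, ·)` at the
new state (and keeps `(x, w)` when it holds) has the same Dirichlet form on functions of `x`, a right
spectral gap that is never larger than that of `Π`, and never smaller than `min{Gap_R(Π), 1 − r^*}`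
— the holding probability caps the rate at which the auxiliary coordinate is refreshed.  This is
the device behind [cite: AndrieuVihola2016, Theorem 10 (d)] (pseudo-marginal chains ordered in the
convex order have `Gap_R(P̃₁) ≥ min{Gap_R(P̃₂), 1 − ρ̃₂^*}`: the augmented chain `P̆₂` of §5 is
`(P̃₂)_ν` with `ν` the conditional law `K₁` of the less noisy weight given the noisier one) and
behind the "perturbed Metropolis–Hastings algorithms" of [cite: AndrieuVihola2016, Appendix,
Proposition 44].

FINITE FORM (this file; the vocabulary of `PeskunOrdering.lean`: `piInner`, `dirichletForm`,
`spectralGapR`, `DetailedBalance`, `IsRowStochastic`).  `E`, `S` finite; `μ : E → ℝ`, `μ ≥ 0`;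
`p : Matrix E E ℝ`, `p ≥ 0`; `r : E → ℝ` with `Σ_y p x y + r x = 1`; the kernel `Π` is
`p + diagonal r`; `ν : E → S → ℝ`, `ν ≥ 0`, `Σ_w ν x w = 1`.

* `augKernel p r ν` — `Π_ν((x,w),(y,u)) = p x y · ν y u + [ (x,w) = (y,u) ] · r x`;
  `augWeight μ ν (x,w) = μ x · ν x w`; `augKernel_isRowStochastic`.
* `augWeight_detailedBalance` — (a): `μ`-reversibility of `p` gives `μ_ν`-reversibility of `Π_ν`.
* `dirichletForm_augKernel_lift` — (b): `𝓔_{Π_ν}(f ∘ fst) = 𝓔_{p + diag r}(f)`.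
* `dirichletForm_augKernel_eq` — the identity of the printed proof,
  `𝓔_{Π_ν}(F) = 𝓔_Π(F₀) + ⟨F̄, (1 − r) F̄⟩_{μ_ν}` with `F₀(x) = Σ_w ν x w F(x,w)`, `F̄ = F − F₀`
  ("It is straightforward to check that `Π_ν f₀(x,w) = Π f₀(x)` and that `Π_ν f = Π f₀ + r f̄`").
* `spectralGapR_augKernel_le` — (c), right inequality: `Gap_R(Π_ν) ≤ Gap_R(Π)` ("by restricting to
  functions constant in the second variable"), under the proviso that `(E, μ)` carries at least one
  admissible test function (mean zero, unit norm) — on a one-point `μ` the tree's `spectralGapR`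
  is the infimum of the empty set, `0` by Mathlib's convention, while `Gap_R(Π_ν)` can be positive.
* **`min_le_spectralGapR_augKernel`** — (c), left inequality: if `r x ≤ ρ` for all `x` then
  `min{Gap_R(Π), 1 − ρ} ≤ Gap_R(Π_ν)` ("note that `⟨f̄,(1 − r)f̄⟩ ≥ (1 − r^*)‖f̄‖²` and
  `⟨f₀,(I − Π)f₀⟩ ≥ Gap(Π)‖f₀‖²`.  The claim follows because `‖f₀‖² + ‖f̄‖² = 1`").  Stated with any
  uniform bound `ρ` on the holding probabilities in place of the essential supremum.

Not here: item (d) (left spectral gaps — the tree has no `Gap_L` yet); general state spaces;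
Remark 46.  TODO(general form).

Context: cell pub-lqcd (venture LatticeQCDFlow), R2-SCOPE.md §3 E2 D2 / E6: with
`PseudoMarginalVarianceOrder.lean` (Theorem 10 (c)) this is the remaining analytic input of
[AndrieuVihola2016, Theorem 10 (d)] — the spectral-gap (geometric-rate) face of "noisier
pseudofermion estimates cost"; the assembly of (d) itself (the augmented pseudo-marginal chain `P̆₂`
and Theorem 22 (d)) is left to a sequel.

## References
* [AndrieuVihola2016] C. Andrieu, M. Vihola, Establishing some order amongst exact approximations of
  MCMCs, Ann. Appl. Probab. 26 (2016) 2661–2696, arXiv:1404.6909; Appendix "Spectral gaps of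
  augmented kernels", Lemma 45; §3 (definition of `Gap_R`); Theorem 10 (d); §5.
-/

namespace Literature.Probability.MarkovChains

open Finset Matrix

variable {E S : Type*} [Fintype E] [DecidableEq E] [Fintype S] [DecidableEq S]

/-! ## The augmented kernel and its invariant weight -/

/-- The AUGMENTED KERNEL `Π_ν((x,w),(y,u)) = p x y · ν y u + [ (x,w) = (y,u) ] · r x`: move with the
sub-kernel `p` and redraw the auxiliary coordinate from `ν(y, ·)` at the new state, or hold `(x, w)`
with probability `r x`. [cite: AndrieuVihola2016, Appendix Lemma 45 (the display defining `Π_ν`)] -/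
noncomputable def augKernel (p : Matrix E E ℝ) (r : E → ℝ) (ν : E → S → ℝ) :
    Matrix (E × S) (E × S) ℝ :=
  Matrix.of fun a b => p a.1 b.1 * ν b.1 b.2 + if a = b then r a.1 else 0

/-- The weight `μ_ν(x, w) = μ x · ν x w`. [cite: AndrieuVihola2016, Appendix Lemma 45 (a)
(`μ_ν(dx × dw) = μ(dx)ν(x, dw)`)] -/
def augWeight (μ : E → ℝ) (ν : E → S → ℝ) : E × S → ℝ := fun a => μ a.1 * ν a.1 a.2

omit [Fintype E] [Fintype S] [DecidableEq E] [DecidableEq S] in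
/-- Unfolding `μ_ν`. [cite: AndrieuVihola2016, Appendix Lemma 45 (a)] -/
@[simp] theorem augWeight_apply (μ : E → ℝ) (ν : E → S → ℝ) (a : E × S) :
    augWeight μ ν a = μ a.1 * ν a.1 a.2 := rfl

omit [Fintype E] [Fintype S] in
/-- Unfolding `Π_ν`. [cite: AndrieuVihola2016, Appendix Lemma 45 (the display defining `Π_ν`)] -/
theorem augKernel_apply (p : Matrix E E ℝ) (r : E → ℝ) (ν : E → S → ℝ) (a b : E × S) :
    augKernel p r ν a b = p a.1 b.1 * ν b.1 b.2 + if a = b then r a.1 else 0 := rfl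

omit [Fintype E] [Fintype S] in
/-- `Π_ν ≥ 0` entrywise. [cite: AndrieuVihola2016, Appendix Lemma 45 (hypotheses `p ≥ 0`,
`r ∈ [0,1]`, `ν` a probability kernel)] -/
theorem augKernel_nonneg {p : Matrix E E ℝ} {r : E → ℝ} {ν : E → S → ℝ} (hp : ∀ x y, 0 ≤ p x y)
    (hr : ∀ x, 0 ≤ r x) (hν : ∀ x w, 0 ≤ ν x w) (a b : E × S) : 0 ≤ augKernel p r ν a b := by
  rw [augKernel_apply]
  refine add_nonneg (mul_nonneg (hp _ _) (hν _ _)) ?_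
  split_ifs
  · exact hr _
  · exact le_rfl

/-- Row sums of `Π_ν`: `Σ_{(y,u)} Π_ν((x,w),(y,u)) = Σ_y p x y + r x`. [cite: AndrieuVihola2016,
Appendix Lemma 45 ("`Π_ν` … Markov kernel")] -/
theorem sum_augKernel (p : Matrix E E ℝ) (r : E → ℝ) {ν : E → S → ℝ} (hν1 : ∀ x, ∑ w, ν x w = 1)
    (a : E × S) : ∑ b, augKernel p r ν a b = ∑ y, p a.1 y + r a.1 := by
  have h1 : ∑ b : E × S, p a.1 b.1 * ν b.1 b.2 = ∑ y, p a.1 y := by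
    rw [Fintype.sum_prod_type]
    exact sum_congr rfl fun y _ => by dsimp only; rw [← mul_sum, hν1 y, mul_one]
  have h2 : ∑ b : E × S, (if a = b then r a.1 else (0 : ℝ)) = r a.1 := by
    rw [Finset.sum_ite_eq, if_pos (mem_univ a)]
  simp only [augKernel_apply, sum_add_distrib, h1, h2]

/-- `Π_ν` is row-stochastic when `Σ_y p x y + r x = 1`. [cite: AndrieuVihola2016, Appendix Lemma 45] -/
theorem augKernel_isRowStochastic {p : Matrix E E ℝ} {r : E → ℝ} {ν : E → S → ℝ}
    (hp : ∀ x y, 0 ≤ p x y) (hr : ∀ x, 0 ≤ r x) (hrow : ∀ x, ∑ y, p x y + r x = 1)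
    (hν : ∀ x w, 0 ≤ ν x w) (hν1 : ∀ x, ∑ w, ν x w = 1) :
    IsRowStochastic (augKernel p r ν) :=
  ⟨augKernel_nonneg hp hr hν, fun a => by rw [sum_augKernel p r hν1 a]; exact hrow a.1⟩

omit [Fintype E] [Fintype S] in
/-- **(a) Reversibility.** If `p` is in detailed balance with `μ` then `Π_ν` is in detailed balance
with `μ_ν` ("follows from `μ_ν(dx × dw) p(x,dy) ν(y,du) = μ_ν(dy × du) p(y,dx) ν(x,dw)`").
[cite: AndrieuVihola2016, Appendix Lemma 45 (a)] -/
theorem augWeight_detailedBalance {μ : E → ℝ} {p : Matrix E E ℝ} (hDB : DetailedBalance μ p)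
    (r : E → ℝ) (ν : E → S → ℝ) :
    DetailedBalance (augWeight μ ν) (augKernel p r ν) := by
  intro a b
  simp only [augWeight_apply, augKernel_apply, mul_add]
  congr 1
  · have h := hDB a.1 b.1
    calc μ a.1 * ν a.1 a.2 * (p a.1 b.1 * ν b.1 b.2)
        = μ a.1 * p a.1 b.1 * (ν a.1 a.2 * ν b.1 b.2) := by ring
      _ = μ b.1 * p b.1 a.1 * (ν a.1 a.2 * ν b.1 b.2) := by rw [h]
      _ = μ b.1 * ν b.1 b.2 * (p b.1 a.1 * ν a.1 a.2) := by ring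
  · by_cases hab : a = b
    · subst hab; simp
    · simp [hab, Ne.symm hab]

/-! ## (b) The Dirichlet form on functions of the first coordinate -/

/-- **(b)** `𝓔_{Π_ν}(f ∘ fst) = 𝓔_Π(f)` for `Π = p + diagonal r`: on functions constant in the
auxiliary variable the augmented chain has the Dirichlet form of `Π` (the holding terms vanish on
both sides, and `ν` integrates out). [cite: AndrieuVihola2016, Appendix Lemma 45 (b)] -/
theorem dirichletForm_augKernel_lift (μ : E → ℝ) (p : Matrix E E ℝ) (r : E → ℝ) {ν : E → S → ℝ}
    (hν1 : ∀ x, ∑ w, ν x w = 1) (f : E → ℝ) :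
    dirichletForm (augWeight μ ν) (augKernel p r ν) (fun a => f a.1) =
      dirichletForm μ (p + diagonal r) f := by
  classical
  unfold dirichletForm
  congr 1
  -- holding terms vanish on both sides
  have hL : ∀ a b : E × S, augWeight μ ν a * augKernel p r ν a b * (f a.1 - f b.1) ^ 2 =
      μ a.1 * ν a.1 a.2 * (p a.1 b.1 * ν b.1 b.2) * (f a.1 - f b.1) ^ 2 := by
    intro a b
    rw [augWeight_apply, augKernel_apply]
    by_cases hab : a = b
    · subst hab; simp
    · simp [hab]
  have hR : ∀ x y : E, μ x * (p + diagonal r) x y * (f x - f y) ^ 2 =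
      μ x * p x y * (f x - f y) ^ 2 := by
    intro x y
    rw [Matrix.add_apply]
    by_cases hxy : x = y
    · subst hxy; simp
    · rw [diagonal_apply_ne _ hxy, add_zero]
  simp only [hL, hR, Fintype.sum_prod_type]
  refine sum_congr rfl fun x _ => ?_
  rw [sum_comm]
  refine sum_congr rfl fun y _ => ?_
  calc ∑ w, ∑ u, μ x * ν x w * (p x y * ν y u) * (f x - f y) ^ 2
      = (μ x * p x y * (f x - f y) ^ 2) * ((∑ w, ν x w) * ∑ u, ν y u) := by
        rw [sum_mul_sum, mul_sum]
        refine sum_congr rfl fun w _ => ?_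
        rw [mul_sum]
        exact sum_congr rfl fun u _ => by ring
    _ = μ x * p x y * (f x - f y) ^ 2 := by rw [hν1 x, hν1 y, one_mul, mul_one]

/-! ## The decomposition `F = F₀ + F̄` and the identity of the printed proof -/

/-- `F₀(x) = Σ_w ν x w F(x, w)`, the `ν(x,·)`-average of `F` over the auxiliary variable
("`f₀(x,w) = f₀(x) := ∫ν(x,dw) f(x,w)`"). [cite: AndrieuVihola2016, Appendix Lemma 45 (proof)] -/
def condMean (ν : E → S → ℝ) (F : E × S → ℝ) : E → ℝ := fun x => ∑ w, ν x w * F (x, w)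

omit [Fintype E] [DecidableEq E] [DecidableEq S] in
/-- Unfolding `F₀`. [cite: AndrieuVihola2016, Appendix Lemma 45 (proof)] -/
theorem condMean_apply (ν : E → S → ℝ) (F : E × S → ℝ) (x : E) :
    condMean ν F x = ∑ w, ν x w * F (x, w) := rfl

omit [Fintype E] [DecidableEq E] [DecidableEq S] in
/-- `Σ_w ν x w (F(x,w) − F₀ x) = 0`. [cite: AndrieuVihola2016, Appendix Lemma 45 (proof,
`f̄ = f − f₀`)] -/
theorem sum_mul_sub_condMean {ν : E → S → ℝ} (hν1 : ∀ x, ∑ w, ν x w = 1) (F : E × S → ℝ)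
    (x : E) : ∑ w, ν x w * (F (x, w) - condMean ν F x) = 0 := by
  simp only [mul_sub, sum_sub_distrib, ← sum_mul, hν1 x, one_mul, condMean_apply, sub_self]

omit [Fintype E] [DecidableEq E] [DecidableEq S] in
/-- Variance decomposition in the auxiliary variable:
`Σ_w ν x w F(x,w)² = F₀ x² + Σ_w ν x w (F(x,w) − F₀ x)²`. [cite: AndrieuVihola2016, Appendix
Lemma 45 (proof, "`1 = ‖f‖² = ‖f₀‖² + ‖f̄‖²`")] -/
theorem sum_mul_sq_eq_condMean {ν : E → S → ℝ} (hν1 : ∀ x, ∑ w, ν x w = 1) (F : E × S → ℝ)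
    (x : E) : ∑ w, ν x w * F (x, w) ^ 2 =
      condMean ν F x ^ 2 + ∑ w, ν x w * (F (x, w) - condMean ν F x) ^ 2 := by
  have h0 := sum_mul_sub_condMean hν1 F x
  have e : ∀ w, ν x w * (F (x, w) - condMean ν F x) ^ 2 =
      ν x w * F (x, w) ^ 2 - 2 * condMean ν F x * (ν x w * (F (x, w) - condMean ν F x)) -
        condMean ν F x ^ 2 * ν x w := by
    intro w; ring
  simp only [e, sum_sub_distrib, ← mul_sum, h0, hν1 x, mul_zero, sub_zero, mul_one]
  ring

/-- `Π_ν F (x,w) = (p F₀)(x) + r x · F(x,w)` ("`Π_ν f = Π f₀ + r f̄`", written with `p`).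
[cite: AndrieuVihola2016, Appendix Lemma 45 (proof)] -/
theorem augKernel_mulVec_apply (p : Matrix E E ℝ) (r : E → ℝ) (ν : E → S → ℝ) (F : E × S → ℝ)
    (a : E × S) :
    (augKernel p r ν *ᵥ F) a = ∑ y, p a.1 y * condMean ν F y + r a.1 * F a := by
  have h1 : ∑ b : E × S, p a.1 b.1 * ν b.1 b.2 * F b = ∑ y, p a.1 y * condMean ν F y := by
    rw [Fintype.sum_prod_type]
    refine sum_congr rfl fun y _ => ?_
    rw [condMean_apply, mul_sum]
    exact sum_congr rfl fun u _ => by ring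
  have h2 : ∑ b : E × S, (if a = b then r a.1 else 0) * F b = r a.1 * F a := by
    simp only [ite_mul, zero_mul, Finset.sum_ite_eq, Finset.mem_univ, if_true]
  simp only [mulVec, dotProduct, augKernel_apply, add_mul, sum_add_distrib, h1, h2]

omit [DecidableEq E] [DecidableEq S] in
/-- `Σ_{(x,w)} μ x ν x w · f x = Σ_x μ x · f x` (the auxiliary law integrates out).
[cite: AndrieuVihola2016, Appendix Lemma 45 (b)] -/
theorem sum_augWeight_mul_lift {μ : E → ℝ} {ν : E → S → ℝ} (hν1 : ∀ x, ∑ w, ν x w = 1)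
    (f : E → ℝ) : ∑ a, augWeight μ ν a * f a.1 = ∑ x, μ x * f x := by
  rw [Fintype.sum_prod_type]
  refine sum_congr rfl fun x _ => ?_
  simp only [augWeight_apply]
  rw [← sum_mul, ← mul_sum, hν1 x, mul_one]

omit [DecidableEq E] [DecidableEq S] in
/-- `⟨f ∘ fst, g ∘ fst⟩_{μ_ν} = ⟨f, g⟩_μ`. [cite: AndrieuVihola2016, Appendix Lemma 45 (b)
(`‖f₀‖_μ = ‖f‖_{μ_ν}` for `f` constant in the second variable)] -/
theorem piInner_augWeight_lift {μ : E → ℝ} {ν : E → S → ℝ} (hν1 : ∀ x, ∑ w, ν x w = 1)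
    (f g : E → ℝ) :
    piInner (augWeight μ ν) (fun a => f a.1) (fun a => g a.1) = piInner μ f g := by
  unfold piInner
  exact sum_augWeight_mul_lift hν1 (fun x => f x * g x)

omit [DecidableEq E] [DecidableEq S] in
/-- The `μ_ν`-mean of `F` is the `μ`-mean of `F₀`. [cite: AndrieuVihola2016, Appendix Lemma 45
(proof)] -/
theorem sum_augWeight_mul_eq_condMean (μ : E → ℝ) (ν : E → S → ℝ) (F : E × S → ℝ) :
    ∑ a, augWeight μ ν a * F a = ∑ x, μ x * condMean ν F x := by
  rw [Fintype.sum_prod_type]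
  refine sum_congr rfl fun x _ => ?_
  simp only [augWeight_apply, condMean_apply, mul_sum]
  exact sum_congr rfl fun w _ => by ring

omit [DecidableEq E] [DecidableEq S] in
/-- `‖F‖²_{μ_ν} = ‖F₀‖²_μ + ‖F̄‖²_{μ_ν}` ("`1 = ‖f‖² = ‖f₀‖² + ‖f̄‖²`").
[cite: AndrieuVihola2016, Appendix Lemma 45 (proof)] -/
theorem piInner_augWeight_self_eq {μ : E → ℝ} {ν : E → S → ℝ} (hν1 : ∀ x, ∑ w, ν x w = 1)
    (F : E × S → ℝ) :
    piInner (augWeight μ ν) F F = piInner μ (condMean ν F) (condMean ν F) +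
      ∑ x, ∑ w, μ x * ν x w * (F (x, w) - condMean ν F x) ^ 2 := by
  unfold piInner
  rw [Fintype.sum_prod_type, ← sum_add_distrib]
  refine sum_congr rfl fun x _ => ?_
  have h := sum_mul_sq_eq_condMean hν1 F x
  calc ∑ w, augWeight μ ν (x, w) * (F (x, w) * F (x, w))
      = μ x * ∑ w, ν x w * F (x, w) ^ 2 := by
        rw [mul_sum]; exact sum_congr rfl fun w _ => by rw [augWeight_apply]; ring
    _ = μ x * (condMean ν F x * condMean ν F x) +
          ∑ w, μ x * ν x w * (F (x, w) - condMean ν F x) ^ 2 := by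
        rw [h, sq, mul_add, mul_sum]
        exact congrArg _ (sum_congr rfl fun w _ => by ring)

/-- `Π = p + diagonal r` is row-stochastic. [cite: AndrieuVihola2016, Appendix Lemma 45
(`Π(x,dy) = p(x,dy) + δ_x(dy) r(x)`)] -/
theorem isRowStochastic_add_diagonal {p : Matrix E E ℝ} {r : E → ℝ} (hp : ∀ x y, 0 ≤ p x y)
    (hr : ∀ x, 0 ≤ r x) (hrow : ∀ x, ∑ y, p x y + r x = 1) :
    IsRowStochastic (p + diagonal r) := by
  refine ⟨fun x y => ?_, fun x => ?_⟩
  · rw [Matrix.add_apply]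
    by_cases hxy : x = y
    · subst hxy; rw [diagonal_apply_eq]; exact add_nonneg (hp x x) (hr x)
    · rw [diagonal_apply_ne _ hxy, add_zero]; exact hp x y
  · simp only [Matrix.add_apply, sum_add_distrib]
    rw [show ∑ y, diagonal r x y = r x by
      rw [sum_eq_single x (fun y _ hyx => diagonal_apply_ne _ (Ne.symm hyx)) (by simp),
        diagonal_apply_eq]]
    exact hrow x

omit [Fintype E] in
/-- Detailed balance of `p` passes to `Π = p + diagonal r`. [cite: AndrieuVihola2016, Appendix
Lemma 45 (hypothesis "`Π` … reversible with respect to … `μ`")] -/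
theorem detailedBalance_add_diagonal {μ : E → ℝ} {p : Matrix E E ℝ} (hDB : DetailedBalance μ p)
    (r : E → ℝ) : DetailedBalance μ (p + diagonal r) := by
  intro x y
  simp only [Matrix.add_apply, mul_add]
  congr 1
  · exact hDB x y
  · by_cases hxy : x = y
    · subst hxy; rfl
    · rw [diagonal_apply_ne _ hxy, diagonal_apply_ne _ (Ne.symm hxy), mul_zero, mul_zero]

/-- **The identity of the printed proof**: for `Π = p + diagonal r` with `p` in detailed balance
with `μ`, `𝓔_{Π_ν}(F) = 𝓔_Π(F₀) + Σ_{x,w} μ x ν x w (1 − r x) (F(x,w) − F₀ x)²`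
("`⟨f, Π_ν f⟩_{μ_ν} = ⟨f₀, Π f₀⟩_μ + ⟨f̄, r f̄⟩_{μ_ν}`"). [cite: AndrieuVihola2016, Appendix Lemma
45 (proof, eq. (aug-dirichlet))] -/
theorem dirichletForm_augKernel_eq {μ : E → ℝ} {p : Matrix E E ℝ} {r : E → ℝ} {ν : E → S → ℝ}
    (hp : ∀ x y, 0 ≤ p x y) (hr : ∀ x, 0 ≤ r x) (hrow : ∀ x, ∑ y, p x y + r x = 1)
    (hν : ∀ x w, 0 ≤ ν x w) (hν1 : ∀ x, ∑ w, ν x w = 1) (hDB : DetailedBalance μ p)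
    (F : E × S → ℝ) :
    dirichletForm (augWeight μ ν) (augKernel p r ν) F =
      dirichletForm μ (p + diagonal r) (condMean ν F) +
        ∑ x, ∑ w, μ x * ν x w * (1 - r x) * (F (x, w) - condMean ν F x) ^ 2 := by
  classical
  have hK := isRowStochastic_add_diagonal hp hr hrow
  have hKν := augKernel_isRowStochastic hp hr hrow hν hν1
  have hst : IsStationary μ (p + diagonal r) :=
    (detailedBalance_add_diagonal hDB r).isStationary hK.2
  have hstν : IsStationary (augWeight μ ν) (augKernel p r ν) :=
    (augWeight_detailedBalance hDB r ν).isStationary hKν.2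
  rw [dirichletForm_eq hKν hstν, dirichletForm_eq hK hst, piInner_augWeight_self_eq hν1]
  -- `⟨F, Π_ν F⟩_{μ_ν} = Σ μ F₀ (p F₀) + Σ_x r x (μ x F₀ x² + ‖F̄(x,·)‖²)`
  have hB : piInner (augWeight μ ν) F (augKernel p r ν *ᵥ F) =
      ∑ x, μ x * condMean ν F x * (∑ y, p x y * condMean ν F y) +
        ∑ x, r x * (μ x * (condMean ν F x * condMean ν F x) +
          ∑ w, μ x * ν x w * (F (x, w) - condMean ν F x) ^ 2) := by
    unfold piInner
    rw [Fintype.sum_prod_type, ← sum_add_distrib]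
    refine sum_congr rfl fun x _ => ?_
    simp only [augKernel_mulVec_apply, augWeight_apply]
    have e : ∀ w, μ x * ν x w * (F (x, w) * (∑ y, p x y * condMean ν F y + r x * F (x, w))) =
        μ x * (∑ y, p x y * condMean ν F y) * (ν x w * F (x, w)) +
          r x * μ x * (ν x w * F (x, w) ^ 2) := fun w => by ring
    have hV : ∑ w, μ x * ν x w * (F (x, w) - condMean ν F x) ^ 2 =
        μ x * ∑ w, ν x w * (F (x, w) - condMean ν F x) ^ 2 := by
      rw [mul_sum]; exact sum_congr rfl fun w _ => by ring
    rw [sum_congr rfl fun w _ => e w, sum_add_distrib, ← mul_sum, ← mul_sum, ← condMean_apply,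
      sum_mul_sq_eq_condMean hν1 F x, hV]
    ring
  -- `⟨F₀, Π F₀⟩_μ = Σ μ F₀ (p F₀) + Σ r μ F₀²`
  have hD : piInner μ (condMean ν F) ((p + diagonal r) *ᵥ condMean ν F) =
      ∑ x, μ x * condMean ν F x * (∑ y, p x y * condMean ν F y) +
        ∑ x, r x * (μ x * (condMean ν F x * condMean ν F x)) := by
    unfold piInner
    rw [← sum_add_distrib]
    refine sum_congr rfl fun x _ => ?_
    have e : ((p + diagonal r) *ᵥ condMean ν F) x =
        ∑ y, p x y * condMean ν F y + r x * condMean ν F x := by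
      simp only [mulVec, dotProduct, Matrix.add_apply, add_mul, sum_add_distrib]
      congr 1
      rw [sum_eq_single x (fun y _ hyx => by rw [diagonal_apply_ne _ (Ne.symm hyx), zero_mul])
        (by simp), diagonal_apply_eq]
    rw [e]
    ring
  rw [hB, hD]
  have eV : ∑ x, ∑ w, μ x * ν x w * (1 - r x) * (F (x, w) - condMean ν F x) ^ 2 =
      ∑ x, (1 - r x) * ∑ w, μ x * ν x w * (F (x, w) - condMean ν F x) ^ 2 := by
    refine sum_congr rfl fun x _ => ?_
    rw [mul_sum]
    exact sum_congr rfl fun w _ => by ring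
  rw [eV]
  unfold piInner
  simp only [← sum_add_distrib, ← sum_sub_distrib]
  exact sum_congr rfl fun x _ => by ring

/-! ## Scaling of the Dirichlet form (private helpers) -/

omit [DecidableEq E] in
/-- `𝓔(c • u) = c² 𝓔(u)`. [folklore] -/
private theorem dirichletForm_smul' (μ : E → ℝ) (P : Matrix E E ℝ) (c : ℝ) (u : E → ℝ) :
    dirichletForm μ P (c • u) = c ^ 2 * dirichletForm μ P u := by
  unfold dirichletForm
  have h : ∀ x y, μ x * P x y * ((c • u) x - (c • u) y) ^ 2 =
      c ^ 2 * (μ x * P x y * (u x - u y) ^ 2) := by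
    intro x y; simp only [Pi.smul_apply, smul_eq_mul]; ring
  simp only [h, ← Finset.mul_sum]
  ring

omit [DecidableEq E] in
/-- `Gap_R(P) · ‖f‖² ≤ 𝓔_P(f)` for every `μ`-mean-zero `f` (scale `f` to unit norm; trivial when
`‖f‖ = 0`). [cite: AndrieuVihola2016, Appendix Lemma 45 (proof: "`⟨f₀,(I − Π)f₀⟩_μ ≥
Gap(Π)‖f₀‖²_μ`")] -/
theorem spectralGapR_mul_le_dirichletForm {μ : E → ℝ} (hμ : ∀ x, 0 ≤ μ x) {P : Matrix E E ℝ}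
    (hP : ∀ x y, 0 ≤ P x y) {f : E → ℝ} (hf0 : ∑ x, μ x * f x = 0) :
    spectralGapR μ P * piInner μ f f ≤ dirichletForm μ P f := by
  have hnn : 0 ≤ piInner μ f f :=
    sum_nonneg fun x _ => mul_nonneg (hμ x) (mul_self_nonneg _)
  rcases hnn.eq_or_lt with h0 | hpos
  · rw [← h0, mul_zero]; exact dirichletForm_nonneg hμ hP f
  · have hc2 : ((Real.sqrt (piInner μ f f))⁻¹) ^ 2 = (piInner μ f f)⁻¹ := by
      rw [inv_pow, Real.sq_sqrt hpos.le]
    have hsm : ∀ c : ℝ, ∑ x, μ x * (c • f) x = c * ∑ x, μ x * f x := by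
      intro c; rw [Finset.mul_sum]
      exact sum_congr rfl fun x _ => by simp only [Pi.smul_apply, smul_eq_mul]; ring
    have hsc : ∀ c : ℝ, piInner μ (c • f) (c • f) = c ^ 2 * piInner μ f f := by
      intro c; unfold piInner; rw [Finset.mul_sum]
      exact sum_congr rfl fun x _ => by simp only [Pi.smul_apply, smul_eq_mul]; ring
    have hg0 : ∑ x, μ x * ((Real.sqrt (piInner μ f f))⁻¹ • f) x = 0 := by
      rw [hsm, hf0, mul_zero]
    have hg1 : piInner μ ((Real.sqrt (piInner μ f f))⁻¹ • f)
        ((Real.sqrt (piInner μ f f))⁻¹ • f) = 1 := by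
      rw [hsc, hc2, inv_mul_cancel₀ hpos.ne']
    have h := spectralGapR_le_dirichletForm hμ hP hg0 hg1
    rw [dirichletForm_smul', hc2] at h
    rwa [← le_div_iff₀ hpos, div_eq_inv_mul]

/-! ## (c) The spectral-gap sandwich -/

/-- **(c), right inequality: `Gap_R(Π_ν) ≤ Gap_R(Π)`** — "by restricting to functions constant in
the second variable".  Proviso (finite bookkeeping): `(E, μ)` admits at least one test function of
mean zero and unit norm; on a one-point `μ` the tree's `spectralGapR` is the infimum of the empty
set (`0` by convention) while `Gap_R(Π_ν)` can be positive. [cite: AndrieuVihola2016, Appendix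
Lemma 45 (c)] -/
theorem spectralGapR_augKernel_le {μ : E → ℝ} (hμ : ∀ x, 0 ≤ μ x) {p : Matrix E E ℝ}
    (hp : ∀ x y, 0 ≤ p x y) {r : E → ℝ} (hr : ∀ x, 0 ≤ r x) {ν : E → S → ℝ}
    (hν : ∀ x w, 0 ≤ ν x w) (hν1 : ∀ x, ∑ w, ν x w = 1)
    (hne : ∃ f : E → ℝ, ∑ x, μ x * f x = 0 ∧ piInner μ f f = 1) :
    spectralGapR (augWeight μ ν) (augKernel p r ν) ≤ spectralGapR μ (p + diagonal r) := by
  classical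
  obtain ⟨f₁, hf₁⟩ := hne
  refine le_csInf ⟨_, ⟨f₁, hf₁, rfl⟩⟩ ?_
  rintro _ ⟨f, ⟨hf0, hf1⟩, rfl⟩
  beta_reduce
  have hF0 : ∑ a, augWeight μ ν a * (fun a : E × S => f a.1) a = 0 := by
    rw [sum_augWeight_mul_lift hν1 f, hf0]
  have hF1 : piInner (augWeight μ ν) (fun a : E × S => f a.1) (fun a => f a.1) = 1 := by
    rw [piInner_augWeight_lift hν1, hf1]
  calc spectralGapR (augWeight μ ν) (augKernel p r ν)
      ≤ dirichletForm (augWeight μ ν) (augKernel p r ν) (fun a => f a.1) :=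
        spectralGapR_le_dirichletForm (fun a => mul_nonneg (hμ _) (hν _ _))
          (augKernel_nonneg hp hr hν) hF0 hF1
    _ = dirichletForm μ (p + diagonal r) f := dirichletForm_augKernel_lift μ p r hν1 f

/-- **(c), left inequality: `min{Gap_R(Π), 1 − r^*} ≤ Gap_R(Π_ν)`**, with any uniform bound `ρ`,
`r x ≤ ρ`, in place of the essential supremum `r^*`: for an admissible `F`,
`𝓔_{Π_ν}(F) = 𝓔_Π(F₀) + ⟨F̄,(1 − r)F̄⟩ ≥ Gap_R(Π)‖F₀‖² + (1 − ρ)‖F̄‖²` and `‖F₀‖² + ‖F̄‖² = 1`.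
Requires `p` in detailed balance with `μ` (reversibility of `Π`). [cite: AndrieuVihola2016, Appendix
Lemma 45 (c)] -/
theorem min_le_spectralGapR_augKernel {μ : E → ℝ} (hμ : ∀ x, 0 ≤ μ x) {p : Matrix E E ℝ}
    (hp : ∀ x y, 0 ≤ p x y) {r : E → ℝ} (hr : ∀ x, 0 ≤ r x) (hrow : ∀ x, ∑ y, p x y + r x = 1)
    {ν : E → S → ℝ} (hν : ∀ x w, 0 ≤ ν x w) (hν1 : ∀ x, ∑ w, ν x w = 1)
    (hDB : DetailedBalance μ p) {ρ : ℝ} (hρ : ∀ x, r x ≤ ρ) :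
    min (spectralGapR μ (p + diagonal r)) (1 - ρ) ≤
      spectralGapR (augWeight μ ν) (augKernel p r ν) := by
  classical
  set A : Set (E → ℝ) := {f | ∑ x, μ x * f x = 0 ∧ piInner μ f f = 1} with hA
  set Aν : Set (E × S → ℝ) :=
    {F | ∑ a, augWeight μ ν a * F a = 0 ∧ piInner (augWeight μ ν) F F = 1} with hAν
  by_cases hS : Aν.Nonempty
  · refine le_csInf (hS.image _) ?_
    rintro _ ⟨F, ⟨hF0, hF1⟩, rfl⟩
    beta_reduce
    have hK := isRowStochastic_add_diagonal hp hr hrow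
    rw [dirichletForm_augKernel_eq hp hr hrow hν hν1 hDB F]
    set F₀ := condMean ν F
    -- the two squared norms
    set a := piInner μ F₀ F₀ with ha
    set b := ∑ x, ∑ w, μ x * ν x w * (F (x, w) - F₀ x) ^ 2 with hb
    have hab : a + b = 1 := by rw [ha, hb, ← piInner_augWeight_self_eq hν1 F, hF1]
    have ha0 : 0 ≤ a := sum_nonneg fun x _ => mul_nonneg (hμ x) (mul_self_nonneg _)
    have hb0 : 0 ≤ b := sum_nonneg fun x _ => sum_nonneg fun w _ =>
      mul_nonneg (mul_nonneg (hμ x) (hν x w)) (sq_nonneg _)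
    have hF00 : ∑ x, μ x * F₀ x = 0 := by rw [← sum_augWeight_mul_eq_condMean, hF0]
    have h1 : spectralGapR μ (p + diagonal r) * a ≤ dirichletForm μ (p + diagonal r) F₀ :=
      spectralGapR_mul_le_dirichletForm hμ hK.1 hF00
    have h2 : (1 - ρ) * b ≤ ∑ x, ∑ w, μ x * ν x w * (1 - r x) * (F (x, w) - F₀ x) ^ 2 := by
      rw [hb, mul_sum]
      refine sum_le_sum fun x _ => ?_
      rw [mul_sum]
      refine sum_le_sum fun w _ => ?_
      calc (1 - ρ) * (μ x * ν x w * (F (x, w) - F₀ x) ^ 2)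
          = μ x * ν x w * (1 - ρ) * (F (x, w) - F₀ x) ^ 2 := by ring
        _ ≤ μ x * ν x w * (1 - r x) * (F (x, w) - F₀ x) ^ 2 :=
          mul_le_mul_of_nonneg_right (mul_le_mul_of_nonneg_left (by linarith [hρ x])
            (mul_nonneg (hμ x) (hν x w))) (sq_nonneg _)
    have hm1 := mul_le_mul_of_nonneg_right (min_le_left (spectralGapR μ (p + diagonal r)) (1 - ρ)) ha0
    have hm2 := mul_le_mul_of_nonneg_right (min_le_right (spectralGapR μ (p + diagonal r)) (1 - ρ)) hb0
    calc min (spectralGapR μ (p + diagonal r)) (1 - ρ)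
        = min (spectralGapR μ (p + diagonal r)) (1 - ρ) * a +
            min (spectralGapR μ (p + diagonal r)) (1 - ρ) * b := by rw [← mul_add, hab, mul_one]
      _ ≤ spectralGapR μ (p + diagonal r) * a + (1 - ρ) * b := add_le_add hm1 hm2
      _ ≤ _ := add_le_add h1 h2
  · -- no admissible function on `E × S`: then none on `E` either, both gaps are `sInf ∅ = 0`
    have hempty : Aν = ∅ := Set.not_nonempty_iff_eq_empty.1 hS
    have hAe : A = ∅ := by
      refine Set.eq_empty_iff_forall_notMem.2 fun f hf => ?_
      have : (fun a : E × S => f a.1) ∈ Aν :=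
        ⟨by rw [sum_augWeight_mul_lift hν1 f, hf.1], by rw [piInner_augWeight_lift hν1, hf.2]⟩
      rw [hempty] at this
      exact this
    have h1 : spectralGapR μ (p + diagonal r) = 0 := by
      unfold spectralGapR; rw [← hA, hAe, Set.image_empty, Real.sInf_empty]
    have h2 : spectralGapR (augWeight μ ν) (augKernel p r ν) = 0 := by
      unfold spectralGapR; rw [← hAν, hempty, Set.image_empty, Real.sInf_empty]
    rw [h1, h2]
    exact min_le_left _ _

end Literature.Probability.MarkovChains
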